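import Summits.AtomisticToContinuum.HydrodynamicLimit.Theses.InformationPercolationEngine
import Summits.AtomisticToContinuum.HydrodynamicLimit.Theorems.ImplosionDichotomyHydroLimitInBandCore
import Summits.AtomisticToContinuum.HydrodynamicLimit.Theorems.ImplosionDichotomyHydroLimitInBandEquilibrium
import Summits.AtomisticToContinuum.HydrodynamicLimit.Theorems.DenseExcursion.Negative.Untied
import Summits.AtomisticToContinuum.HydrodynamicLimit.Theorems.LocalSecondLaw.Negative.HomogeneousLLN
import Summits.AtomisticToContinuum.HydrodynamicLimit.Theorems.KineticWindowGronwall.Negative.ConsequentLoadBearing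

/-!
# `ChaosClosesEuler` (stmt-AtomisticToContinuum-15141): what a refutation would be, and the load-bearing
# hypotheses of its conclusion

Negative-side structure for the crux `InformationPercolationEngine.ChaosClosesEuler` (the kinetic dock of route
InformationPercolationEngine, rev 8: `ContactChaos → CollisionRate → LocalSecondLaw → HydroLimitInBand`), from the
standing disprover's `Cruxes/ChaosClosesEuler/Disproof.lean` (cycle 1).  Everything is sorry-free.

* §1 **No witness can kill the crux.**  Its conclusion is, VERBATIM, the packing-guarded conjunct
  `ImplosionDichotomy.HydroLimitInBand` (stmt-9133; `Iff.rfl`), which the sub-problem statement implies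
  (`Theorems.hydroLimitInBand_of_hydrodynamicLimit`).  Hence `not_hydrodynamicLimit_of_not_chaosClosesEuler`:
  an unconditional refutation of the crux refutes the summit conjunct; and `not_chaosClosesEuler_iff` /
  `not_chaosClosesEuler_iff_pinned`: `¬ChaosClosesEuler` is EXACTLY "the three open-problem antecedents hold AND,
  for every packing guard, some pinned classical hard-sphere Euler solution in the band fails the law of large
  numbers at some pre-shock time through every flow family" (the pinned-data core of 9133,
  `HydroLimitInBandCore.not_hydroLimitInBand_iff_pinned`).  A refutation of any antecedent instead makes the crux
  trivially true, so the node can only die as MISSTATED (an antecedent too weak for the dock — the fate of its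
  predecessor KineticClosure, stmt-13482), never by a counterexample.
* §2 **The `t = 0` tie is load-bearing in the conclusion** (`conclusion_false_without_tie`): with the hypothesis
  `TendstoHydroFieldsAt … 0 →` deleted, the two constant classical states `(1,0,1)` and `(1,0,2)` (both in the band)
  would make the conserved empirical energy converge in probability to `3/2` and to `3` under the same
  homogeneous local Gibbs laws (Alexander flows `PolynomialCompressionPDE.flows_nonempty`, probability laws
  `isProbabilityMeasure_localGibbsLaw`); limits in probability are unique (`limit_unique`).  No dynamics.
* §3 **The Euler balance laws are load-bearing in the conclusion** (`conclusion_false_noPDE`): with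
  `IsHardSphereEulerSolution σ T ρ u θ` WEAKENED to its joint smoothness and positivity fields (the three balance
  laws deleted; tie and guard kept), the tied homogeneous data `(1,1,0)` (identified `t = 0` LLN,
  `LocalSecondLawNegative.homogeneous_lln_identified`) and the smooth positive heating state `(1, 0, 1 + t)`
  (`KineticWindowGronwallNegative.ramp`) would force the empirical energy at `t = 1/2` to converge both to `9/4`
  (the heating target) and to `3/2` (the constant target, also tied) — contradiction.
So every proof of the dock consumes the tie (as the line's `stub_initialLayer` does) and the PDE (as the relative
energy does); nothing else about the conclusion's frame is negotiable: dropping the guard or the smallness of `σ`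
yields `HydrodynamicLimit`-strength statements.  refuter-cdisprove-stmt-AtomisticToContinuum-15141-0.
-/

noncomputable section

namespace Summit.AtomisticToContinuum.HydrodynamicLimit.Theorems.ChaosClosesEulerNegative

open MeasureTheory Filter Set Topology
open scoped ENNReal
open Literature.MathematicalPhysics.KineticTheory Literature.Analysis.FluidPDE
open Summit.AtomisticToContinuum.HydrodynamicLimit.Theses.InformationPercolationEngine
open Summit.AtomisticToContinuum.HydrodynamicLimit.Theorems.DenseExcursionUntied (isHardSphereEulerSolution_const)
open Summit.AtomisticToContinuum.HydrodynamicLimit.Theorems.LocalSecondLawNegative (homogeneous_lln_identified)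
open Summit.AtomisticToContinuum.HydrodynamicLimit.Theorems.PolynomialCompressionPDE (Flows flows_nonempty)
open Summit.AtomisticToContinuum.HydrodynamicLimit.Theorems.KineticWindowGronwallNegative
  (tendstoHydroFieldsAt_congr_slices ramp isSmoothSpaceTimeOn_ramp)

/-! ## §1 What a refutation of the crux is -/

/-- **A refutation of the crux refutes the summit conjunct.**  The crux's conclusion is (definitionally) the
guarded conjunct `ImplosionDichotomy.HydroLimitInBand`, implied by `HydrodynamicLimit`
(`Theorems.hydroLimitInBand_of_hydrodynamicLimit`), and the conclusion alone proves the crux. [folklore] -/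
theorem not_hydrodynamicLimit_of_not_chaosClosesEuler (h : ¬ ChaosClosesEuler) : ¬ _root_.HydrodynamicLimit :=
  fun H => h fun _ _ _ =>
    Summit.AtomisticToContinuum.HydrodynamicLimit.Theorems.hydroLimitInBand_of_hydrodynamicLimit H

/-- **`¬ChaosClosesEuler` unfolded.**  The crux fails iff its three antecedents — each an open-problem crux of the
route (stmt-13477, 13481, 13081) — are TRUE and the guarded conjunct (stmt-9133) is FALSE. [folklore] -/
theorem not_chaosClosesEuler_iff :
    ¬ ChaosClosesEuler ↔ (ContactChaos ∧ CollisionRate ∧ LocalSecondLaw ∧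
      ¬ Summit.AtomisticToContinuum.HydrodynamicLimit.Theses.ImplosionDichotomy.HydroLimitInBand) := by
  rw [show ChaosClosesEuler ↔ (ContactChaos → CollisionRate → LocalSecondLaw →
      Summit.AtomisticToContinuum.HydrodynamicLimit.Theses.ImplosionDichotomy.HydroLimitInBand) from Iff.rfl,
    Classical.not_imp, Classical.not_imp, Classical.not_imp]

/-- **The refutation obligation in pinned form.**  `¬ChaosClosesEuler` iff the three antecedents hold and, for
EVERY guard `η₀ > 0`, some continuous positive profiles carry, below every threshold `σ₀`, a classical hard-sphere
Euler solution with the PINNED data `(rhoLim (profileOf a₀) σ, u₀, θ₀)` and packing `< η₀` whose law of large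
numbers fails at some `t < T` through every flow family (`HydroLimitInBandCore.not_hydroLimitInBand_iff_pinned`).
In words: besides proving molecular chaos at contact, the Enskog rate and the local second law, a disprover must
exhibit a pre-shock failure of hydrodynamics for deterministic hard spheres. [folklore] -/
theorem not_chaosClosesEuler_iff_pinned :
    ¬ ChaosClosesEuler ↔ (ContactChaos ∧ CollisionRate ∧ LocalSecondLaw ∧
      ∀ η₀ : ℝ, 0 < η₀ → ∃ (a₀ θ₀ : T3 → ℝ) (u₀ : T3 → V3) (ha : Continuous a₀) (ha0 : ∀ x, 0 < a₀ x),
        Continuous θ₀ ∧ Continuous u₀ ∧ (∀ x, 0 < θ₀ x) ∧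
        ∀ σ₀ : ℝ, 0 < σ₀ → ∃ σ : ℝ, 0 < σ ∧ σ < σ₀ ∧
          ∃ (T : ℝ) (ρ θ : ℝ → T3 → ℝ) (u : ℝ → T3 → V3), IsHardSphereEulerSolution σ T ρ u θ ∧
            ρ 0 = rhoLim (profileOf a₀ ha ha0) σ ∧ u 0 = u₀ ∧ θ 0 = θ₀ ∧
            (∀ t ∈ Ico 0 T, ∀ x, ρ t x * σ ^ 3 < η₀) ∧
            ∀ Φ : Flows σ, ∃ t ∈ Ico 0 T,
              ¬ TendstoHydroFieldsAt (fun N => localGibbsLaw σ a₀ u₀ θ₀ N (Φ N)) Φ ρ u θ t) := by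
  rw [not_chaosClosesEuler_iff, HydroLimitInBandCore.not_hydroLimitInBand_iff_pinned]

/-! ## §2 The `t = 0` tie is load-bearing in the conclusion -/

/-- Limits in probability are unique (laws of total mass `1`). [folklore] -/
theorem limit_unique {Ω : ℕ → Type*} [∀ N, MeasurableSpace (Ω N)]
    {P : (N : ℕ) → Measure (Ω N)} (hP : ∀ N, P N Set.univ = 1) {F : (N : ℕ) → Ω N → ℝ} {a b : ℝ}
    (ha : ∀ δ > (0 : ℝ), Tendsto (fun N => P N {z | δ < |F N z - a|}) atTop (𝓝 0))
    (hb : ∀ δ > (0 : ℝ), Tendsto (fun N => P N {z | δ < |F N z - b|}) atTop (𝓝 0)) : a = b := by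
  by_contra hne
  have hab : 0 < |a - b| := abs_pos.2 (sub_ne_zero.2 hne)
  have hle : ∀ N, (1 : ℝ≥0∞) ≤
      P N {z | |a - b| / 3 < |F N z - a|} + P N {z | |a - b| / 3 < |F N z - b|} := by
    intro N
    rw [← hP N]
    refine (measure_mono fun z _ => ?_).trans (measure_union_le _ _)
    by_contra hz
    simp only [Set.mem_union, Set.mem_setOf_eq, not_or, not_lt] at hz
    have h1 : |a - b| ≤ |F N z - a| + |F N z - b| := by
      calc |a - b| = |(F N z - b) - (F N z - a)| := by ring_nf
        _ ≤ |F N z - b| + |F N z - a| := abs_sub _ _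
        _ = |F N z - a| + |F N z - b| := add_comm _ _
    linarith [hz.1, hz.2]
  have h0 : Tendsto (fun N => P N {z | |a - b| / 3 < |F N z - a|} +
      P N {z | |a - b| / 3 < |F N z - b|}) atTop (𝓝 0) := by
    simpa using (ha _ (by positivity)).add (hb _ (by positivity))
  exact absurd (ge_of_tendsto' h0 hle) (by simp)

/-- The total energy of the constant state `(1, 0, c)` tested against `χ ≡ 1` is `3c/2` (unit-volume torus),
in the syntactic shape produced by `TendstoHydroFieldsAt` for time-constant fields. [folklore] -/
theorem integral_totalEnergyDensity_const (c s : ℝ) :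
    ∫ x : T3, (fun _ : T3 => (1 : ℝ)) x * totalEnergyDensity ((fun (_ : ℝ) (_ : T3) => (1 : ℝ)) s x)
      ((fun (_ : ℝ) (_ : T3) => (0 : V3)) s x) ((fun (_ : ℝ) (_ : T3) => c) s x) = 3 / 2 * c := by
  haveI : IsProbabilityMeasure (volume : Measure T3) := by
    rw [volume_pi]; infer_instance
  simp [totalEnergyDensity, integral_const]

/-- A reduced density below three thresholds at once: `σ < σ₀`, `σ < σ₁`, `σ³ < η₀`. [folklore] -/
theorem exists_small_sigma {σ₀ σ₁ η₀ : ℝ} (hσ₀ : 0 < σ₀) (hσ₁ : 0 < σ₁) (hη₀ : 0 < η₀) :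
    ∃ σ : ℝ, 0 < σ ∧ σ < σ₀ ∧ σ < σ₁ ∧ σ ^ 3 < η₀ := by
  set s := min (min σ₀ σ₁) (min η₀ 1) / 2 with hs
  have hm : 0 < min (min σ₀ σ₁) (min η₀ 1) := lt_min (lt_min hσ₀ hσ₁) (lt_min hη₀ one_pos)
  have hs0 : 0 < s := by positivity
  refine ⟨s, hs0, ?_, ?_, ?_⟩
  · linarith [min_le_left (min σ₀ σ₁) (min η₀ 1), min_le_left σ₀ σ₁]
  · linarith [min_le_left (min σ₀ σ₁) (min η₀ 1), min_le_right σ₀ σ₁]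
  · have hs1 : s < 1 := by linarith [min_le_right (min σ₀ σ₁) (min η₀ 1), min_le_right η₀ (1 : ℝ)]
    have hsη : s < η₀ := by linarith [min_le_right (min σ₀ σ₁) (min η₀ 1), min_le_left η₀ (1 : ℝ)]
    calc s ^ 3 ≤ s ^ 1 := pow_le_pow_of_le_one hs0.le hs1.le (by norm_num)
      _ = s := pow_one s
      _ < η₀ := hsη

/-- **The `t = 0` tie is load-bearing**: the crux's conclusion `HydroLimitInBand` with the single hypothesis
`TendstoHydroFieldsAt … 0 →` DELETED (everything else verbatim) is FALSE.  Witness: profiles `(1,1,0)`,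
Alexander flows, the constant classical states `(1,0,1)` and `(1,0,2)` on `[0,1)` (in the band once `σ³ < η₀`),
`t = 0`, test `χ ≡ 1`: the empirical energy would converge in probability to `3/2` and to `3`. [folklore] -/
theorem conclusion_false_without_tie :
    ¬ (∃ η₀ : ℝ, 0 < η₀ ∧ ∀ (a₀ θ₀ : T3 → ℝ) (u₀ : T3 → V3), Continuous a₀ → Continuous θ₀ → Continuous u₀ →
      (∀ x, 0 < a₀ x) → (∀ x, 0 < θ₀ x) → ∃ σ₀ : ℝ, 0 < σ₀ ∧ ∀ σ : ℝ, 0 < σ → σ < σ₀ →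
      ∀ (T : ℝ) (ρ θ : ℝ → T3 → ℝ) (u : ℝ → T3 → V3), IsHardSphereEulerSolution σ T ρ u θ →
      (∀ t ∈ Set.Ico 0 T, ∀ x, ρ t x * σ ^ 3 < η₀) →
      ∀ Φ : (N : ℕ) → HardSphereFlow (Torus.geometry (Fin 3)) (hsDiameter σ N) (N + 1),
      ∀ t ∈ Set.Ico 0 T, TendstoHydroFieldsAt (fun N => localGibbsLaw σ a₀ u₀ θ₀ N (Φ N)) Φ ρ u θ t) := by
  rintro ⟨η₀, hη₀, H⟩
  obtain ⟨σ₀, hσ₀, hσ⟩ := H (fun _ => 1) (fun _ => 1) (fun _ => 0) continuous_const continuous_const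
    continuous_const (fun _ => one_pos) (fun _ => one_pos)
  obtain ⟨σ, hσpos, hσlt0, hσhalf, hσcube⟩ := exists_small_sigma hσ₀ (show (0 : ℝ) < 1 / 2 by norm_num) hη₀
  obtain ⟨Φ⟩ := flows_nonempty hσpos hσhalf
  have hband : ∀ t ∈ Set.Ico (0 : ℝ) 1, ∀ x : T3, (fun (_ : ℝ) (_ : T3) => (1 : ℝ)) t x * σ ^ 3 < η₀ :=
    fun t _ x => by simpa using hσcube
  have h1 := hσ σ hσpos hσlt0 1 (fun _ _ => 1) (fun _ _ => 1) (fun _ _ => 0)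
    (isHardSphereEulerSolution_const σ 1 0 one_pos one_pos) hband Φ 0 ⟨le_rfl, one_pos⟩
  have h2 := hσ σ hσpos hσlt0 1 (fun _ _ => 1) (fun _ _ => 2) (fun _ _ => 0)
    (isHardSphereEulerSolution_const σ 1 0 one_pos two_pos) hband Φ 0 ⟨le_rfl, one_pos⟩
  have hP : ∀ N, localGibbsLaw σ (fun _ => 1) (fun _ => 0) (fun _ => 1) N (Φ N) Set.univ = 1 := by
    intro N
    haveI := isProbabilityMeasure_localGibbsLaw (a₀ := fun _ => (1 : ℝ)) (θ₀ := fun _ => (1 : ℝ))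
      (u₀ := fun _ => (0 : V3)) continuous_const continuous_const continuous_const
      (fun _ => one_pos) (fun _ => one_pos) hσhalf.le N (Φ N)
    exact measure_univ
  have hE : (3 / 2 : ℝ) * 1 = 3 / 2 * 2 := by
    refine limit_unique (P := fun N => localGibbsLaw σ (fun _ => 1) (fun _ => 0) (fun _ => 1) N (Φ N)) hP
      (F := fun N z => empiricalEnergyField ((Φ N).flow 0 z) (fun _ => 1)) (fun δ hδ => ?_) (fun δ hδ => ?_)
    · have h := (h1 (fun _ => 1) continuous_const δ hδ).2.2
      rw [integral_totalEnergyDensity_const 1 0] at h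
      exact h
    · have h := (h2 (fun _ => 1) continuous_const δ hδ).2.2
      rw [integral_totalEnergyDensity_const 2 0] at h
      exact h
  norm_num at hE

/-! ## §3 The Euler balance laws are load-bearing in the conclusion -/

/-- **The Euler balance laws are load-bearing**: the crux's conclusion with `IsHardSphereEulerSolution σ T ρ u θ`
WEAKENED to joint smoothness and positivity of `(ρ, u, θ)` on `[0,T) × 𝕋³` (the three balance laws deleted; the
guard and the `t = 0` tie kept verbatim) is FALSE.  Witness: profiles `(1,1,0)` with the identified `t = 0` LLN
(`homogeneous_lln_identified`), Alexander flows, `T = 1`, the smooth positive heating state `(1, 0, 1 + t)` and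
the constant solution `(1, 0, 1)` — both tied at `t = 0`, both in the band; at `t = 1/2` the empirical energy
would converge in probability to `9/4` and to `3/2`. [folklore] -/
theorem conclusion_false_noPDE :
    ¬ (∃ η₀ : ℝ, 0 < η₀ ∧ ∀ (a₀ θ₀ : T3 → ℝ) (u₀ : T3 → V3), Continuous a₀ → Continuous θ₀ → Continuous u₀ →
      (∀ x, 0 < a₀ x) → (∀ x, 0 < θ₀ x) → ∃ σ₀ : ℝ, 0 < σ₀ ∧ ∀ σ : ℝ, 0 < σ → σ < σ₀ →
      ∀ (T : ℝ) (ρ θ : ℝ → T3 → ℝ) (u : ℝ → T3 → V3),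
      Literature.Analysis.FunctionSpaces.Torus.IsSmoothSpaceTimeOn (Set.Ico 0 T) ρ →
      Literature.Analysis.FunctionSpaces.Torus.IsSmoothSpaceTimeOn (Set.Ico 0 T) u →
      Literature.Analysis.FunctionSpaces.Torus.IsSmoothSpaceTimeOn (Set.Ico 0 T) θ →
      (∀ t ∈ Set.Ico 0 T, ∀ x, 0 < ρ t x) → (∀ t ∈ Set.Ico 0 T, ∀ x, 0 < θ t x) →
      (∀ t ∈ Set.Ico 0 T, ∀ x, ρ t x * σ ^ 3 < η₀) →
      ∀ Φ : (N : ℕ) → HardSphereFlow (Torus.geometry (Fin 3)) (hsDiameter σ N) (N + 1),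
      TendstoHydroFieldsAt (fun N => localGibbsLaw σ a₀ u₀ θ₀ N (Φ N)) Φ ρ u θ 0 →
      ∀ t ∈ Set.Ico 0 T, TendstoHydroFieldsAt (fun N => localGibbsLaw σ a₀ u₀ θ₀ N (Φ N)) Φ ρ u θ t) := by
  rintro ⟨η₀, hη₀, H⟩
  obtain ⟨σ₀, hσ₀, hσ⟩ := H (fun _ => 1) (fun _ => 1) (fun _ => 0) continuous_const continuous_const
    continuous_const (fun _ => one_pos) (fun _ => one_pos)
  obtain ⟨σ₁, hσ₁, hσ₁h, hlln⟩ := homogeneous_lln_identified one_pos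
  obtain ⟨σ, hσpos, hσlt0, hσlt1, hσcube⟩ := exists_small_sigma hσ₀ hσ₁ hη₀
  have hσhalf : σ < 1 / 2 := lt_of_lt_of_le hσlt1 hσ₁h
  obtain ⟨Φ⟩ := flows_nonempty hσpos hσhalf
  have hband : ∀ t ∈ Set.Ico (0 : ℝ) 1, ∀ x : T3, (fun (_ : ℝ) (_ : T3) => (1 : ℝ)) t x * σ ^ 3 < η₀ :=
    fun t _ x => by simpa using hσcube
  have hsol := isHardSphereEulerSolution_const σ 1 (0 : V3) one_pos one_pos
  have h0 : TendstoHydroFieldsAt (fun N => localGibbsLaw σ (fun _ => 1) (fun _ => 0) (fun _ => 1) N (Φ N)) Φ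
      (fun _ _ => (1 : ℝ)) (fun _ _ => (0 : V3)) (fun _ _ => (1 : ℝ)) 0 := hlln σ hσpos hσlt1 Φ
  -- the heating target `(1, 0, 1 + t)`: same time-0 slice, so it is tied as well
  have hramp0 : ramp 0 = (fun (_ : ℝ) (_ : T3) => (1 : ℝ)) 0 := by funext x; simp [ramp]
  have h0' : TendstoHydroFieldsAt (fun N => localGibbsLaw σ (fun _ => 1) (fun _ => 0) (fun _ => 1) N (Φ N)) Φ
      (fun _ _ => (1 : ℝ)) (fun _ _ => (0 : V3)) ramp 0 :=
    (tendstoHydroFieldsAt_congr_slices (ρ := fun _ _ => (1 : ℝ)) (u := fun _ _ => (0 : V3))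
      (θ := ramp) (θ' := fun _ _ => (1 : ℝ)) (t := 0) rfl rfl hramp0).2 h0
  have ht : (1 / 2 : ℝ) ∈ Set.Ico (0 : ℝ) 1 := ⟨by norm_num, by norm_num⟩
  have hpos1 : ∀ t ∈ Set.Ico (0 : ℝ) 1, ∀ x : T3, (0 : ℝ) < (fun (_ : ℝ) (_ : T3) => (1 : ℝ)) t x :=
    fun _ _ _ => one_pos
  have hposr : ∀ t ∈ Set.Ico (0 : ℝ) 1, ∀ x : T3, (0 : ℝ) < ramp t x := fun t ht' x => by
    simp only [ramp]; linarith [ht'.1]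
  have h1 := hσ σ hσpos hσlt0 1 (fun _ _ => 1) (fun _ _ => 1) (fun _ _ => 0) hsol.smooth_density
    hsol.smooth_velocity hsol.smooth_temperature hpos1 hpos1 hband Φ h0 (1 / 2) ht
  have h2 := hσ σ hσpos hσlt0 1 (fun _ _ => 1) ramp (fun _ _ => 0) hsol.smooth_density hsol.smooth_velocity
    (isSmoothSpaceTimeOn_ramp _) hpos1 hposr hband Φ h0' (1 / 2) ht
  -- read the heating statement at `t = 1/2` as the constant state `(1, 0, 3/2)`
  have hramp : ramp (1 / 2) = (fun (_ : ℝ) (_ : T3) => (3 / 2 : ℝ)) (1 / 2) := by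
    funext x; norm_num [ramp]
  have h2' : TendstoHydroFieldsAt (fun N => localGibbsLaw σ (fun _ => 1) (fun _ => 0) (fun _ => 1) N (Φ N)) Φ
      (fun _ _ => (1 : ℝ)) (fun _ _ => (0 : V3)) (fun _ _ => (3 / 2 : ℝ)) (1 / 2) :=
    (tendstoHydroFieldsAt_congr_slices (ρ := fun _ _ => (1 : ℝ)) (u := fun _ _ => (0 : V3))
      (θ := ramp) (θ' := fun _ _ => (3 / 2 : ℝ)) (t := 1 / 2) rfl rfl hramp).1 h2
  have hP : ∀ N, localGibbsLaw σ (fun _ => 1) (fun _ => 0) (fun _ => 1) N (Φ N) Set.univ = 1 := by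
    intro N
    haveI := isProbabilityMeasure_localGibbsLaw (a₀ := fun _ => (1 : ℝ)) (θ₀ := fun _ => (1 : ℝ))
      (u₀ := fun _ => (0 : V3)) continuous_const continuous_const continuous_const
      (fun _ => one_pos) (fun _ => one_pos) hσhalf.le N (Φ N)
    exact measure_univ
  have hE : (3 / 2 : ℝ) * 1 = 3 / 2 * (3 / 2) := by
    refine limit_unique (P := fun N => localGibbsLaw σ (fun _ => 1) (fun _ => 0) (fun _ => 1) N (Φ N)) hP
      (F := fun N z => empiricalEnergyField ((Φ N).flow (1 / 2) z) (fun _ => 1)) (fun δ hδ => ?_)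
      (fun δ hδ => ?_)
    · have h := (h1 (fun _ => 1) continuous_const δ hδ).2.2
      rw [integral_totalEnergyDensity_const 1 (1 / 2)] at h
      exact h
    · have h := (h2' (fun _ => 1) continuous_const δ hδ).2.2
      rw [integral_totalEnergyDensity_const (3 / 2) (1 / 2)] at h
      exact h
  norm_num at hE

end Summit.AtomisticToContinuum.HydrodynamicLimit.Theorems.ChaosClosesEulerNegative

end
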